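import Summits.HubbardSuperconductivity.HubbardSuperconductivity.Theorems.NodalDiracTwistDiskTrivialHolonomyOverlap

/-!
# Route `NodalDiracTwist` — support `DiskTrivialHolonomy`, part 2: link variables on a polar grid

Helper file for stmt-HubbardSuperconductivity-1627 (`DiskTrivialHolonomy`), continuing
`NodalDiracTwistDiskTrivialHolonomyOverlap`. Elementary ingredients of the lattice (link-variable)
computation of the holonomy of a line bundle over a disk (Fukui–Hatsugai–Suzuki, J. Phys. Soc.
Jpn. 74 (2005) 1674): the triangle lemma (`triangle_re_pos`: three unit vectors with pairwise
overlaps `|⟨a,b⟩|², |⟨a,c⟩|² > 9/10` have cyclic product of positive real part), the cyclic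
cancellation of phases (`prod_star_smul_dotProduct_smul`), and the geometry of the polar grid
`p + (k/m) r (cos 2πj/n, sin 2πj/n)` (wrap-around of the angular index, sup-metric distances,
membership in the disk). No new definitions.
-/

-- the mandated namespace `Summit.<Summit>.<Problem>.Theorems` repeats `HubbardSuperconductivity`
-- (single-problem summit, D-0017), which the `dupNamespace` linter flags on every declaration
set_option linter.dupNamespace false

namespace Summit.HubbardSuperconductivity.HubbardSuperconductivity.Theorems.NodalDiracTwist

open Matrix Complex
open scoped ComplexOrder

variable {ι : Type*} [Fintype ι]

/-! ### Overlaps: conjugate symmetry and the triangle lemma -/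

/-- `⟨v, u⟩ = conj ⟨u, v⟩` for the sesquilinear dot product. [folklore] -/
theorem star_dotProduct_comm_conj (u v : ι → ℂ) :
    star v ⬝ᵥ u = starRingEnd ℂ (star u ⬝ᵥ v) := by
  rw [star_dotProduct, Complex.star_def]

/-- Real parts of `⟨u, v⟩` and `⟨v, u⟩` agree. [folklore] -/
theorem star_dotProduct_comm_re (u v : ι → ℂ) : (star v ⬝ᵥ u).re = (star u ⬝ᵥ v).re := by
  rw [star_dotProduct_comm_conj, Complex.conj_re]

/-- **Triangle lemma.** For unit vectors `a, b, c` with `|⟨a, b⟩|², |⟨a, c⟩|² > 9/10` the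
cyclic product `⟨a, b⟩⟨b, c⟩⟨c, a⟩` has positive real part: writing `b = βa + b'`,
`c = γa + c'` with `b', c' ⊥ a` gives `⟨b, c⟩ = β̄γ + ⟨b', c'⟩` with `|⟨b', c'⟩| ≤ 1/10`, so the
product is `|β|²|γ|² + β⟨b', c'⟩γ̄`, of real part `≥ 0.81 - 0.1`. (Discrete version of the
vanishing of the curvature of a line bundle on small plaquettes; Fukui–Hatsugai–Suzuki, J. Phys.
Soc. Jpn. 74 (2005) 1674, link variables.) [folklore] -/
theorem triangle_re_pos {a b c : ι → ℂ} (ha : star a ⬝ᵥ a = 1) (hb : star b ⬝ᵥ b = 1)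
    (hc : star c ⬝ᵥ c = 1) (hab : 9 / 10 < ‖star a ⬝ᵥ b‖ ^ 2)
    (hac : 9 / 10 < ‖star a ⬝ᵥ c‖ ^ 2) :
    0 < ((star a ⬝ᵥ b) * (star b ⬝ᵥ c) * (star c ⬝ᵥ a)).re := by
  set β := star a ⬝ᵥ b with hβ
  set γ := star a ⬝ᵥ c with hγ
  set b' := b - β • a with hb'
  set c' := c - γ • a with hc'
  have hab' : star a ⬝ᵥ b' = 0 := by
    rw [hb', dotProduct_sub, dotProduct_smul, ha, ← hβ, smul_eq_mul, mul_one, sub_self]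
  have hac' : star a ⬝ᵥ c' = 0 := by
    rw [hc', dotProduct_sub, dotProduct_smul, ha, ← hγ, smul_eq_mul, mul_one, sub_self]
  have hb'a : star b' ⬝ᵥ a = 0 := by rw [star_dotProduct_comm_conj, hab', map_zero]
  -- `⟨b, c⟩ = β̄ γ + ⟨b', c'⟩`
  have hbc : star b ⬝ᵥ c = starRingEnd ℂ β * γ + star b' ⬝ᵥ c' := by
    have hbd : b = β • a + b' := by rw [hb', add_sub_cancel]
    have hcd : c = γ • a + c' := by rw [hc', add_sub_cancel]
    conv_lhs => rw [hbd, hcd]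
    simp only [star_add, star_smul, add_dotProduct, dotProduct_add, smul_dotProduct,
      dotProduct_smul, ha, hac', hb'a, smul_eq_mul, mul_one, mul_zero, add_zero, zero_add,
      Complex.star_def]
    ring
  -- `‖b'‖² = 1 - |β|²`, `‖c'‖² = 1 - |γ|²`
  have hb'n : star b' ⬝ᵥ b' = 1 - (‖β‖ : ℂ) ^ 2 := by
    calc star b' ⬝ᵥ b' = star b' ⬝ᵥ (b - β • a) := rfl
      _ = star b' ⬝ᵥ b := by rw [dotProduct_sub, dotProduct_smul, hb'a, smul_zero, sub_zero]
      _ = star (b - β • a) ⬝ᵥ b := rfl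
      _ = 1 - (‖β‖ : ℂ) ^ 2 := by
          rw [star_sub, star_smul, sub_dotProduct, smul_dotProduct, hb, ← hβ, smul_eq_mul,
            Complex.star_def, Complex.conj_mul']
  have hc'a : star c' ⬝ᵥ a = 0 := by rw [star_dotProduct_comm_conj, hac', map_zero]
  have hc'n : star c' ⬝ᵥ c' = 1 - (‖γ‖ : ℂ) ^ 2 := by
    calc star c' ⬝ᵥ c' = star c' ⬝ᵥ (c - γ • a) := rfl
      _ = star c' ⬝ᵥ c := by rw [dotProduct_sub, dotProduct_smul, hc'a, smul_zero, sub_zero]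
      _ = star (c - γ • a) ⬝ᵥ c := rfl
      _ = 1 - (‖γ‖ : ℂ) ^ 2 := by
          rw [star_sub, star_smul, sub_dotProduct, smul_dotProduct, hc, ← hγ, smul_eq_mul,
            Complex.star_def, Complex.conj_mul']
  have hβ1 : ‖β‖ ≤ 1 := norm_star_dotProduct_le_one ha hb
  have hγ1 : ‖γ‖ ≤ 1 := norm_star_dotProduct_le_one ha hc
  -- the error term
  set e := star b' ⬝ᵥ c' with he
  have he1 : ‖e‖ ≤ 1 / 10 := by
    have h := norm_star_dotProduct_le b' c'
    rw [hb'n, hc'n, ← he] at h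
    have h1 : (1 - (‖β‖ : ℂ) ^ 2).re = 1 - ‖β‖ ^ 2 := by
      rw [Complex.sub_re, Complex.one_re, ← Complex.ofReal_pow, Complex.ofReal_re]
    have h2 : (1 - (‖γ‖ : ℂ) ^ 2).re = 1 - ‖γ‖ ^ 2 := by
      rw [Complex.sub_re, Complex.one_re, ← Complex.ofReal_pow, Complex.ofReal_re]
    rw [h1, h2] at h
    linarith
  have hca : star c ⬝ᵥ a = starRingEnd ℂ γ := by rw [star_dotProduct_comm_conj, ← hγ]
  rw [hbc, hca]
  have hX : β * (starRingEnd ℂ β * γ + e) * starRingEnd ℂ γ =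
      (‖β‖ : ℂ) ^ 2 * (‖γ‖ : ℂ) ^ 2 + β * e * starRingEnd ℂ γ := by
    rw [← Complex.mul_conj' β, ← Complex.mul_conj' γ]
    ring
  rw [hX, Complex.add_re]
  have h1 : ((‖β‖ : ℂ) ^ 2 * (‖γ‖ : ℂ) ^ 2).re = ‖β‖ ^ 2 * ‖γ‖ ^ 2 := by
    rw [← Complex.ofReal_pow, ← Complex.ofReal_pow, ← Complex.ofReal_mul, Complex.ofReal_re]
  have h2 : |(β * e * starRingEnd ℂ γ).re| ≤ 1 / 10 := by
    refine (Complex.abs_re_le_norm _).trans ?_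
    rw [norm_mul, norm_mul, Complex.norm_conj]
    have h := mul_le_mul (mul_le_mul hβ1 he1 (norm_nonneg _) zero_le_one) hγ1 (norm_nonneg _)
      (by positivity)
    linarith
  rw [h1]
  have h3 : 81 / 100 < ‖β‖ ^ 2 * ‖γ‖ ^ 2 := by nlinarith
  linarith [(abs_le.1 h2).1]

/-! ### Cyclic products: phases cancel -/

/-- **Phases cancel cyclically**: for unimodular `z_i` and a permutation `σ`,
`∏_i ⟨z_i s_i, z_{σ i} s_{σ i}⟩ = ∏_i ⟨s_i, s_{σ i}⟩`. (Gauge invariance of the lattice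
holonomy; Fukui–Hatsugai–Suzuki (2005).) [folklore] -/
theorem prod_star_smul_dotProduct_smul {n : ℕ} (σ : Equiv.Perm (Fin n)) (z : Fin n → ℂ)
    (hz : ∀ i, ‖z i‖ = 1) (s : Fin n → ι → ℂ) :
    ∏ i, star (z i • s i) ⬝ᵥ (z (σ i) • s (σ i)) = ∏ i, star (s i) ⬝ᵥ s (σ i) := by
  have h : ∀ i, star (z i • s i) ⬝ᵥ (z (σ i) • s (σ i)) =
      star (z i) * (z (σ i) * (star (s i) ⬝ᵥ s (σ i))) := fun i => by
    rw [star_smul, smul_dotProduct, dotProduct_smul, smul_eq_mul, smul_eq_mul]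
  simp_rw [h]
  rw [Finset.prod_mul_distrib, Finset.prod_mul_distrib,
    Equiv.prod_comp σ z, ← mul_assoc, ← Finset.prod_mul_distrib]
  have h1 : ∏ i, star (z i) * z i = 1 := by
    refine Finset.prod_eq_one fun i _ => ?_
    rw [Complex.star_def, Complex.conj_mul', hz i, Complex.ofReal_one, one_pow]
  rw [h1, one_mul]

/-! ### The polar grid: angles, points, distances -/

/-- The direction of the `j`-th of `n` equally spaced boundary points (the `Fin 2 → ℝ` vector
`(cos 2πj/n, sin 2πj/n)`, written with the `if` of the route statement) only depends on `j` modulo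
`n`: stepping from the last index wraps to the first. [folklore] -/
theorem dir_finRotate {n : ℕ} (i : Fin n) :
    (fun ν : Fin 2 => if ν = 0 then Real.cos (2 * Real.pi * ((finRotate n i : ℕ) : ℝ) / n)
      else Real.sin (2 * Real.pi * ((finRotate n i : ℕ) : ℝ) / n)) =
    fun ν : Fin 2 => if ν = 0 then Real.cos (2 * Real.pi * (((i : ℕ) + 1 : ℕ) : ℝ) / n)
      else Real.sin (2 * Real.pi * (((i : ℕ) + 1 : ℕ) : ℝ) / n) := by
  obtain ⟨n, rfl⟩ : ∃ n', n = n' + 1 := ⟨n - 1, (Nat.succ_pred_eq_of_pos i.pos).symm⟩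
  by_cases h : i = Fin.last n
  · subst h
    rw [finRotate_last, Fin.val_zero, Fin.val_last]
    have hn : ((n + 1 : ℕ) : ℝ) ≠ 0 := by positivity
    have h2 : 2 * Real.pi * ((n + 1 : ℕ) : ℝ) / ((n + 1 : ℕ) : ℝ) = 2 * Real.pi := by
      field_simp
    funext ν
    simp only [Nat.cast_zero, mul_zero, zero_div, Real.cos_zero, Real.sin_zero, h2,
      Real.cos_two_pi, Real.sin_two_pi]
  · rw [coe_finRotate_of_ne_last h]

/-- Distance estimate on the polar grid `v_{k,j} = p + (k/m) r (cos θ_j, sin θ_j)`,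
`θ_j = 2πj/n`, in the sup metric of `Fin 2 → ℝ`: for `k ≤ m`,
`dist(v_{k,j}, v_{k',j'}) ≤ r|θ_j - θ_{j'}| + |k/m - k'/m| r`. [folklore] -/
theorem dist_polarGrid_le (p : Fin 2 → ℝ) {r : ℝ} (hr : 0 ≤ r) {m : ℕ} (hm : 0 < m) (n : ℕ)
    {k : ℕ} (hk : k ≤ m) (k' j j' : ℕ) :
    dist (fun ν : Fin 2 => p ν + (k : ℝ) / m * r *
        (if ν = 0 then Real.cos (2 * Real.pi * (j : ℝ) / n) else Real.sin (2 * Real.pi * (j : ℝ) / n)))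
      (fun ν : Fin 2 => p ν + (k' : ℝ) / m * r *
        (if ν = 0 then Real.cos (2 * Real.pi * (j' : ℝ) / n)
          else Real.sin (2 * Real.pi * (j' : ℝ) / n))) ≤
      r * |2 * Real.pi * (j : ℝ) / n - 2 * Real.pi * (j' : ℝ) / n| +
        |(k : ℝ) / m - (k' : ℝ) / m| * r := by
  have hm' : (0 : ℝ) < m := by exact_mod_cast hm
  have hkm : (k : ℝ) / m ≤ 1 := (div_le_one hm').2 (by exact_mod_cast hk)
  have hkm0 : 0 ≤ (k : ℝ) / m := by positivity
  rw [dist_pi_le_iff (by positivity)]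
  intro ν
  rw [Real.dist_eq]
  set θ := 2 * Real.pi * (j : ℝ) / n
  set θ' := 2 * Real.pi * (j' : ℝ) / n
  -- the two trigonometric components, uniformly
  have key : ∀ f : ℝ → ℝ, (∀ x y, |f x - f y| ≤ |x - y|) → (∀ x, |f x| ≤ 1) →
      |p ν + (k : ℝ) / m * r * f θ - (p ν + (k' : ℝ) / m * r * f θ')| ≤
        r * |θ - θ'| + |(k : ℝ) / m - (k' : ℝ) / m| * r := by
    intro f hlip hbd
    have hsplit : p ν + (k : ℝ) / m * r * f θ - (p ν + (k' : ℝ) / m * r * f θ') =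
        (k : ℝ) / m * r * (f θ - f θ') + ((k : ℝ) / m - (k' : ℝ) / m) * r * f θ' := by ring
    rw [hsplit]
    refine (abs_add_le _ _).trans (add_le_add ?_ ?_)
    · rw [abs_mul, abs_of_nonneg (by positivity : (0 : ℝ) ≤ (k : ℝ) / m * r)]
      calc (k : ℝ) / m * r * |f θ - f θ'| ≤ 1 * r * |θ - θ'| :=
            mul_le_mul (mul_le_mul_of_nonneg_right hkm hr) (hlip θ θ') (abs_nonneg _)
              (by positivity)
        _ = r * |θ - θ'| := by ring
    · rw [abs_mul, abs_mul, abs_of_nonneg hr]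
      calc |(k : ℝ) / m - (k' : ℝ) / m| * r * |f θ'| ≤ |(k : ℝ) / m - (k' : ℝ) / m| * r * 1 := by
            gcongr
            exact hbd θ'
        _ = _ := by ring
  fin_cases ν
  · simpa using key Real.cos Real.abs_cos_sub_cos_le Real.abs_cos_le_one
  · simpa using key Real.sin Real.abs_sin_sub_sin_le Real.abs_sin_le_one

/-- The polar grid point `v_{k,j}` lies in the closed disk of radius `r` when `k ≤ m`. [folklore] -/
theorem polarGrid_mem_disk (p : Fin 2 → ℝ) (r : ℝ) {m : ℕ} (hm : 0 < m) (n : ℕ)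
    {k : ℕ} (hk : k ≤ m) (j : ℕ) :
    ((fun ν : Fin 2 => p ν + (k : ℝ) / m * r *
        (if ν = 0 then Real.cos (2 * Real.pi * (j : ℝ) / n)
          else Real.sin (2 * Real.pi * (j : ℝ) / n))) 0 - p 0) ^ 2 +
      ((fun ν : Fin 2 => p ν + (k : ℝ) / m * r *
        (if ν = 0 then Real.cos (2 * Real.pi * (j : ℝ) / n)
          else Real.sin (2 * Real.pi * (j : ℝ) / n))) 1 - p 1) ^ 2 ≤ r ^ 2 := by
  have hm' : (0 : ℝ) < m := by exact_mod_cast hm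
  have hkm : (k : ℝ) / m ≤ 1 := (div_le_one hm').2 (by exact_mod_cast hk)
  have hkm0 : 0 ≤ (k : ℝ) / m := by positivity
  simp only [if_true, show (1 : Fin 2) ≠ 0 by decide, if_false, add_sub_cancel_left]
  have hcs := Real.cos_sq_add_sin_sq (2 * Real.pi * (j : ℝ) / n)
  have h1 : ((k : ℝ) / m) ^ 2 ≤ 1 := pow_le_one₀ hkm0 hkm
  calc ((k : ℝ) / m * r * Real.cos (2 * Real.pi * (j : ℝ) / n)) ^ 2 +
        ((k : ℝ) / m * r * Real.sin (2 * Real.pi * (j : ℝ) / n)) ^ 2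
        = ((k : ℝ) / m) ^ 2 * r ^ 2 * (Real.cos (2 * Real.pi * (j : ℝ) / n) ^ 2 +
            Real.sin (2 * Real.pi * (j : ℝ) / n) ^ 2) := by ring
    _ ≤ 1 * r ^ 2 * 1 := by
        rw [hcs]
        gcongr
    _ = r ^ 2 := by ring

end Summit.HubbardSuperconductivity.HubbardSuperconductivity.Theorems.NodalDiracTwist
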